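import Mathlib.Data.Finset.Preimage
import Mathlib.Algebra.BigOperators.Group.Finset.Sigma
import Mathlib.Data.Fintype.BigOperators
import Mathlib.Data.Fintype.Sigma
import Mathlib.Data.Fintype.Pi
import Mathlib.Data.Fintype.Powerset
import Mathlib.Algebra.Ring.Defs
import HarnessLib

/-!
# `UV3BranchExpansionPatternReindex` — switch-site patterns as `Finset (Σ i, α i)` versus as level families `(i : ι) → Finset (α i)`:
# the re-indexing adapter between the branch-expansion domination letter and the amortized covering inequality
# (crux `UnitScaleTilt.HistoryTailL`, stmt-QuantumFields-19936 — SUPPLY side, record-independent finite combinatorics)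

Cell `ym3-torus` (YM ladder rung R3 = continuum SU(2) Yang–Mills on T³ — a RUNG, NOT d = 4, NOT infinite volume, NOT a mass gap, NOT Clay);
width seat `ym-ust-19936-w2` (gen 17), explicit-unit helper; `--supports stmt-QuantumFields-19936 --as helper`.  THEOREMS ONLY (0 `def`,
0 `sorry`, default heartbeats, Mathlib + HarnessLib imports only).

WHAT.  ✓`UV3BranchExpansionDomination.map_actual_le_smul_of_branchExpansion` (LEAD ★w1-19936 g12) bounds the top push-forward by
`(Σ_{s ∈ univ ∖ 𝓜} 2^{|s|}·w s) • ν` with `s : Finset ι` ranging over sets of SWITCH SITES, `ι = Σ i, α i` (a level and a bond of that level —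
✓`UV3BranchExpansionGuardedTower` uses `⟨⟨i,hi⟩, c⟩`); ✓`UV3BranchExpansionCountingAmortized.sum_pow_card_le_of_discoverable` (this seat)
bounds `Σ_{p discoverable} x^{Σ_i |p i|}` with PATTERNS `p : (i : ι) → Finset (α i)`.  THIS FILE is the [folklore] dictionary between the two
indexings, for any finite index type `ι` and finite fibres `α i`: the level family of `s` is `i ↦ s.preimage (Sigma.mk i)` (equivalently
`univ.filter (⟨i,·⟩ ∈ s)`, `preimage_mk_eq_filter`), its total size is `|s|` (`card_eq_sum_card_preimage_mk`), and sums over `s` of any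
function of its level family equal the corresponding sums over patterns (★★ `sum_eq_sum_pattern`, ★★ `sum_filter_eq_sum_filter_pattern`,
★ `sum_pow_card_filter_eq`; primed versions with the slices spelled `univ.filter (⟨i,·⟩ ∈ s)` as in the socket) — so the (F-TOP) assembly rewrites `Σ_{s ∉ 𝓜} x^{|s|}` with `𝓜 := {s | ¬ discoverable (levels of s)}` as the
pattern sum of the covering inequality in one line.

HONEST SCOPE.  [folklore] finite re-indexing; nothing model-specific; nothing of hTop, the χ record, (O‴χₛ), `HistoryTailL`, R3 is proved;
the Yang–Mills mass gap is NOT proved.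

References: LEAD note `Cruxes/HistoryTailL/HTopBranchExpansion.md` v1.2 §5–§6 (2026-08-30); T. Bałaban, CMP **102** (1985) 255–275
[Balaban1985UV3].
-/

set_option autoImplicit false

namespace Summit.QuantumFields.YangMills.Theorems.UV3BranchExpansionPatternReindex

open Finset

variable {ι : Type*} [Fintype ι] [DecidableEq ι] {α : ι → Type*}

/-- A finite set of switch sites is the disjoint union over levels of its level slices. [folklore] -/
theorem sigma_univ_preimage_mk (s : Finset (Σ i, α i)) :
    Finset.univ.sigma (fun i => s.preimage (Sigma.mk i) sigma_mk_injective.injOn) = s :=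
  Finset.sigma_preimage_mk_of_subset s (Finset.subset_univ _)

omit [DecidableEq ι] in
/-- The level slice of the set of sites of a pattern is the pattern. [folklore] -/
theorem preimage_mk_sigma (p : (i : ι) → Finset (α i)) (i : ι) :
    (Finset.univ.sigma p).preimage (Sigma.mk i) sigma_mk_injective.injOn = p i := by
  ext c
  simp [Finset.mem_preimage, Finset.mem_sigma]

omit [Fintype ι] in
/-- The level slice as a filter (the letter of ✓`UV3BranchExpansionGuardedTower`). [folklore] -/
theorem preimage_mk_eq_filter [∀ i, Fintype (α i)] [∀ i, DecidableEq (α i)] (s : Finset (Σ i, α i)) (i : ι) :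
    s.preimage (Sigma.mk i) sigma_mk_injective.injOn = Finset.univ.filter (fun c => (⟨i, c⟩ : Σ i, α i) ∈ s) := by
  ext c
  simp [Finset.mem_preimage]

/-- `|s| = Σ_i |slice_i(s)|`. [folklore] -/
theorem card_eq_sum_card_preimage_mk (s : Finset (Σ i, α i)) :
    s.card = ∑ i, (s.preimage (Sigma.mk i) sigma_mk_injective.injOn).card := by
  conv_lhs => rw [← sigma_univ_preimage_mk s]
  rw [Finset.card_sigma]

/-- ★★ **SUMS OVER SITE SETS = SUMS OVER PATTERNS.**  For every function `f` of a level family,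
`Σ_{s : Finset (Σ i, α i)} f (slices of s) = Σ_{p : (i : ι) → Finset (α i)} f p` (the slicing map is a bijection). [folklore] -/
theorem sum_eq_sum_pattern [∀ i, Fintype (α i)] {M : Type*} [AddCommMonoid M]
    (f : ((i : ι) → Finset (α i)) → M) :
    ∑ s : Finset (Σ i, α i), f (fun i => s.preimage (Sigma.mk i) sigma_mk_injective.injOn)
      = ∑ p : ((i : ι) → Finset (α i)), f p := by
  refine Fintype.sum_equiv
    ⟨fun s i => s.preimage (Sigma.mk i) sigma_mk_injective.injOn, fun p => Finset.univ.sigma p,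
      fun s => sigma_univ_preimage_mk s, fun p => funext (fun i => preimage_mk_sigma p i)⟩
    _ _ (fun s => rfl)

/-- ★★ The same with a predicate on the level family on both sides (e.g. «discoverable»). [folklore] -/
theorem sum_filter_eq_sum_filter_pattern [∀ i, Fintype (α i)] [∀ i, DecidableEq (α i)] {M : Type*} [AddCommMonoid M]
    (P : ((i : ι) → Finset (α i)) → Prop) [DecidablePred P] (f : ((i : ι) → Finset (α i)) → M) :
    ∑ s ∈ (Finset.univ : Finset (Finset (Σ i, α i))).filter
        (fun s => P (fun i => s.preimage (Sigma.mk i) sigma_mk_injective.injOn)),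
      f (fun i => s.preimage (Sigma.mk i) sigma_mk_injective.injOn)
      = ∑ p ∈ (Finset.univ : Finset ((i : ι) → Finset (α i))).filter P, f p := by
  rw [Finset.sum_filter, Finset.sum_filter]
  exact sum_eq_sum_pattern (fun p => if P p then f p else 0)

/-- ★ **THE ADAPTER ROW.**  With weights `x^{|s|}`: `Σ_{s | P (slices s)} x^{|s|} = Σ_{p | P p} x^{Σ_i |p i|}` — the left side is the shape of
✓`map_actual_le_smul_of_branchExpansion`'s constant (`2^{|s|}·w s` with `w s = (K_α p_adm)^{|s|}`, `x = 2K_α p_adm`, `𝓜 = {s | ¬P (slices s)}`), the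
right side the shape bounded by ✓`UV3BranchExpansionCountingAmortized.sum_pow_card_le_of_discoverable`. [folklore] -/
theorem sum_pow_card_filter_eq [∀ i, Fintype (α i)] [∀ i, DecidableEq (α i)] {M : Type*} [CommSemiring M]
    (P : ((i : ι) → Finset (α i)) → Prop) [DecidablePred P] (x : M) :
    ∑ s ∈ (Finset.univ : Finset (Finset (Σ i, α i))).filter
        (fun s => P (fun i => s.preimage (Sigma.mk i) sigma_mk_injective.injOn)), x ^ s.card
      = ∑ p ∈ (Finset.univ : Finset ((i : ι) → Finset (α i))).filter P, x ^ (∑ i, (p i).card) := by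
  have h : ∀ s : Finset (Σ i, α i),
      x ^ s.card = x ^ (∑ i, (s.preimage (Sigma.mk i) sigma_mk_injective.injOn).card) := fun s => by
    rw [← card_eq_sum_card_preimage_mk]
  simp_rw [h]
  exact sum_filter_eq_sum_filter_pattern P (fun p => x ^ (∑ i, (p i).card))

/-! ## The same rows with the slices spelled as filters (the spelling of ✓`UV3BranchExpansionGuardedTower` ∕ (F-JOIN)) -/

omit [Fintype ι] in
/-- The slicing map in filter spelling equals the `preimage` spelling, as functions. [folklore] -/
theorem slices_filter_eq_preimage [∀ i, Fintype (α i)] [∀ i, DecidableEq (α i)] (s : Finset (Σ i, α i)) :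
    (fun i => Finset.univ.filter (fun c => (⟨i, c⟩ : Σ i, α i) ∈ s))
      = fun i => s.preimage (Sigma.mk i) sigma_mk_injective.injOn :=
  funext (fun i => (preimage_mk_eq_filter s i).symm)

/-- ★★ `sum_filter_eq_sum_filter_pattern` with filter-spelled slices. [folklore] -/
theorem sum_filter_eq_sum_filter_pattern' [∀ i, Fintype (α i)] [∀ i, DecidableEq (α i)] {M : Type*} [AddCommMonoid M]
    (P : ((i : ι) → Finset (α i)) → Prop) [DecidablePred P] (f : ((i : ι) → Finset (α i)) → M) :
    ∑ s ∈ (Finset.univ : Finset (Finset (Σ i, α i))).filter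
        (fun s => P (fun i => Finset.univ.filter (fun c => (⟨i, c⟩ : Σ i, α i) ∈ s))),
      f (fun i => Finset.univ.filter (fun c => (⟨i, c⟩ : Σ i, α i) ∈ s))
      = ∑ p ∈ (Finset.univ : Finset ((i : ι) → Finset (α i))).filter P, f p := by
  simp_rw [slices_filter_eq_preimage]
  exact sum_filter_eq_sum_filter_pattern P f

/-- ★★ **THE ADAPTER ROW, filter spelling** (the exact seam between (F-JOIN)'s `Σ_{s | discoverable (slices s)} (2Kq)^{#s}` and
✓`sum_pow_card_le_of_discoverable_T3`'s `Σ_{p discoverable} x^{Σ_i #p i}` at `x := 2Kq`):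
`Σ_{s | P (fun i => univ.filter (⟨i,·⟩ ∈ s))} x^{#s} = Σ_{p | P p} x^{Σ_i #p i}`. [folklore] -/
theorem sum_pow_card_filter_eq' [∀ i, Fintype (α i)] [∀ i, DecidableEq (α i)] {M : Type*} [CommSemiring M]
    (P : ((i : ι) → Finset (α i)) → Prop) [DecidablePred P] (x : M) :
    ∑ s ∈ (Finset.univ : Finset (Finset (Σ i, α i))).filter
        (fun s => P (fun i => Finset.univ.filter (fun c => (⟨i, c⟩ : Σ i, α i) ∈ s))), x ^ s.card
      = ∑ p ∈ (Finset.univ : Finset ((i : ι) → Finset (α i))).filter P, x ^ (∑ i, (p i).card) := by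
  simp_rw [slices_filter_eq_preimage]
  exact sum_pow_card_filter_eq P x

end Summit.QuantumFields.YangMills.Theorems.UV3BranchExpansionPatternReindex
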